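import Summits.AtomisticToContinuum.HydrodynamicLimit.Theorems.JParityClosureLocalSecondLawContactDefs
import Literature.Analysis.FluidPDE.HardSphereFlowJointMeasurable
import Mathlib.Probability.Kernel.RadonNikodym
import Mathlib.MeasureTheory.Measure.WithDensityFinite

/-!
# Stub S (`stub_exchangePairing`) of the line `contact-asymmetry-information`, crux `LocalSecondLaw`
(stmt-AtomisticToContinuum-13081) — existence of the slice-wise one-particle density

The EXISTENCE half of stub S (`contact_exchangePairing`), landed as registered sub-lemmas over the part-A vocabulary
(`IsOneParticleDensity`, `condLaw`, `EnsFrame`, `Pt1`):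

* `contactS_exists_isOneParticleDensity` — every finite law `ν ≪ Liouville` on the phase space of `N + 1` hard spheres
  on `𝕋³`, transported by ANY hard-sphere flow `Φ`, has on every horizon `[0, τ]` a slice-wise one-particle density
  `f : ℝ × 𝕋³ × ℝ³ → ℝ`: non-negative, JOINTLY measurable in `(s, x, v)`, and for EVERY time `s` the density of the
  expected empirical one-particle measure `m_s(B) = ∫ (N+1)⁻¹ ∑ᵢ 1_B(Φₛz i) dν` against bounded measurable test
  functions.  Route: `Φₛ` preserves the Liouville measure (`HardSphereFlow.measurePreserving`), the Liouville measure is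
  product Lebesgue measure restricted to the hard-sphere domain and coordinate projections kill Lebesgue-null sets
  (`Measure.pi_eval_preimage_null`), so `m_s ≪ dx dv` for every `s`; the flow is jointly measurable on its good set
  (`HardSphereFlow.measurable_flow_prod_torus`, right-continuity of orbits), so `s ↦ m_s` is a finite KERNEL
  (`contactS_exists_oneParticleKernel`); and Doob's measurable Radon–Nikodym theorem (Mathlib's
  `ProbabilityTheory.Kernel.rnDeriv`, packaged against a σ-finite reference measure in
  `contactS_exists_density_of_kernel`) gives a version of `dm_s/(dx dv)` jointly measurable and valid at every `s`.
* `contactS_exists_isOneParticleDensity_condLaw`, `contactS_oneParticleDensity` — hence every conditioned law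
  `μ(· | S)` of a law `μ ≪ Liouville` has one, in particular the pinned bounded tilts `P_N(· | S)` of the local Gibbs
  law of the ensemble frame `EnsFrame` (no mass floor, pinning or smallness of `σ` needed): the object `f` over which
  stubs S, K1, M, K4, B′ quantify exists unconditionally.

What these do NOT give: the contact density `q` (`IsContactDensity`: measurability of `z ↦ pcollSum σ τ Φ z F` for
bounded measurable `F`, finiteness of the expected collision number of a bounded tilt, absolute continuity of the
expected empirical collision measure on the contact bundle), `Admissible`, and the inequality `𝒦 − P_R ≥ −η` of the
stub (renormalised first-marginal entropy balance + Résibois offset against configurational work: EvenStressEnskog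
stmt-AtomisticToContinuum-13079, open).

References: O. Kallenberg, *Random Measures, Theory and Applications* (2017), Thm 1.28 (measurable Radon–Nikodym
derivatives of kernels); H. Spohn, *Large Scale Dynamics of Interacting Particles* (1991), Part I §3 (one-particle
densities of hard-sphere laws); C. Cercignani, R. Illner, M. Pulvirenti, *The Mathematical Theory of Dilute Gases*
(1994) §4.2 (Liouville invariance of the hard-sphere flow).  Worker of lead seat
prover-line-stmt-AtomisticToContinuum-13081-a5-0.
-/

noncomputable section

open scoped BigOperators Topology Classical MeasureTheory ENNReal InnerProductSpace
open Filter Set MeasureTheory Function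
open Literature.MathematicalPhysics.KineticTheory
open Literature.Analysis.FluidPDE
open Summit.AtomisticToContinuum.HydrodynamicLimit.Theorems.LocalSecondLawNegative
open Summit.AtomisticToContinuum.HydrodynamicLimit.Theorems.LocalSecondLawLedger

namespace Summit.AtomisticToContinuum.HydrodynamicLimit.Theorems.LocalSecondLawContact

variable {N : ℕ}

/-! ## A jointly measurable version of the flow, and an abstract measurable Radon–Nikodym lemma -/

/-- A jointly measurable modification of the flow map `(s, z) ↦ Φₛ z`, equal to it on the good set (off the good set the
flow is junk and only slice-wise measurable; on it, joint measurability is `HardSphereFlow.measurable_flow_prod_torus`,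
right-continuity of hard-sphere orbits). -/
theorem contactS_exists_measurable_flow {σ : ℝ} (Φ : Flow σ N) :
    ∃ Ψ : ℝ × Phase N → Phase N, Measurable Ψ ∧ ∀ s z, z ∈ Φ.good → Ψ (s, z) = Φ.flow s z := by
  classical
  set S : Set (ℝ × Phase N) := {p | p.2 ∈ Φ.good} with hS
  have hSm : MeasurableSet S := measurable_snd Φ.measurableSet_good
  have hf : Measurable fun q : S => Φ.flow q.1.1 q.1.2 := by
    have hm : Measurable fun q : S => ((⟨q.1.2, q.2⟩ : Φ.good), q.1.1) :=
      (measurable_subtype_coe.snd.subtype_mk).prodMk measurable_subtype_coe.fst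
    exact (Φ.measurable_flow_prod_torus).comp hm
  have hg : Measurable fun q : (Sᶜ : Set (ℝ × Phase N)) => q.1.2 := measurable_subtype_coe.snd
  refine ⟨fun p => if hp : p ∈ S then (fun q : S => Φ.flow q.1.1 q.1.2) ⟨p, hp⟩
      else (fun q : (Sᶜ : Set (ℝ × Phase N)) => q.1.2) ⟨p, hp⟩, Measurable.dite hf hg hSm, ?_⟩
  intro s z hz
  have hmem : (s, z) ∈ S := hz
  simp only [hmem, dif_pos]

/-- **Measurable Radon–Nikodym for kernels against a σ-finite reference measure** (Doob; O. Kallenberg, *Random Measures,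
Theory and Applications* (2017), Thm 1.28, through Mathlib's `ProbabilityTheory.Kernel.rnDeriv`): a finite kernel
`κ : α → Measure γ` (`γ` countably generated) all of whose values are absolutely continuous with respect to a σ-finite
measure `μ` has a JOINTLY measurable, non-negative, real density `f` with `κ a = f(a, ·) dμ` for EVERY `a` (the kernel
derivative against the finite measure `μ.toFinite ∼ μ`, times `d(μ.toFinite)/dμ`). -/
theorem contactS_exists_density_of_kernel {α γ : Type*} [MeasurableSpace α] [MeasurableSpace γ]
    [MeasurableSpace.CountableOrCountablyGenerated α γ] (κ : ProbabilityTheory.Kernel α γ)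
    [ProbabilityTheory.IsFiniteKernel κ] (μ : Measure γ) [SigmaFinite μ] (hκ : ∀ a, κ a ≪ μ) :
    ∃ f : α × γ → ℝ, (∀ p, 0 ≤ f p) ∧ Measurable f ∧
      ∀ a, κ a = μ.withDensity (fun x => ENNReal.ofReal (f (a, x))) := by
  classical
  set η : ProbabilityTheory.Kernel α γ := ProbabilityTheory.Kernel.const α μ.toFinite with hη
  have hηa : ∀ a, η a = μ.toFinite := fun a => ProbabilityTheory.Kernel.const_apply _ _
  set r : γ → ℝ≥0∞ := μ.toFinite.rnDeriv μ with hr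
  have hr_meas : Measurable r := Measure.measurable_rnDeriv _ _
  have hr_eq : μ.withDensity r = μ.toFinite :=
    Measure.withDensity_rnDeriv_eq _ _ (toFinite_absolutelyContinuous μ)
  have hr_lt : ∀ᵐ x ∂μ, r x < ∞ := Measure.rnDeriv_lt_top _ _
  set g : α → γ → ℝ≥0∞ := ProbabilityTheory.Kernel.rnDeriv κ η with hg
  have hg_meas : Measurable fun p : α × γ => g p.1 p.2 := ProbabilityTheory.Kernel.measurable_rnDeriv κ η
  have hga : ∀ a, Measurable (g a) := fun a => hg_meas.comp measurable_prodMk_left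
  have hg_lt : ∀ a, ∀ᵐ x ∂μ, g a x < ∞ := by
    intro a
    have h := ProbabilityTheory.Kernel.rnDeriv_lt_top κ η (a := a)
    rw [hηa a, ae_toFinite] at h
    exact h
  have hκ_eq : ∀ a, κ a = μ.withDensity fun x => r x * g a x := by
    intro a
    have h1 : κ a ≪ η a := by
      rw [hηa a]
      exact (hκ a).trans (absolutelyContinuous_toFinite μ)
    have h2 : (η a).withDensity (g a) = κ a := by
      rw [withDensity_congr_ae (ProbabilityTheory.Kernel.rnDeriv_eq_rnDeriv_measure (κ := κ) (η := η) (a := a))]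
      exact Measure.withDensity_rnDeriv_eq _ _ h1
    rw [← h2, hηa a, ← hr_eq, ← withDensity_mul _ hr_meas (hga a)]
    rfl
  refine ⟨fun p => (r p.2 * g p.1 p.2).toReal, fun p => ENNReal.toReal_nonneg, ?_, fun a => ?_⟩
  · exact ((hr_meas.comp measurable_snd).mul hg_meas).ennreal_toReal
  · rw [hκ_eq a]
    refine withDensity_congr_ae ?_
    filter_upwards [hr_lt, hg_lt a] with x hx hgx
    show r x * g a x = ENNReal.ofReal (r x * g a x).toReal
    rw [ENNReal.ofReal_toReal (ENNReal.mul_lt_top hx hgx).ne]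

/-! ## The expected empirical one-particle measures along the flow: a finite kernel, a.c. at every time -/

/-- **The expected empirical one-particle measures of a finite law `ν ≪ Liouville` along a hard-sphere flow on `𝕋³`
form a finite kernel `s ↦ m_s` on `𝕋³ × ℝ³`, absolutely continuous with respect to `dx dv` at EVERY time**, and
`∫ (N+1)⁻¹ ∑ᵢ G(Φₛz i) dν = ∫ G dm_s` for bounded measurable `G` (`Φₛ` preserves the Liouville measure, which is
product Lebesgue measure restricted to the hard-sphere domain, and coordinate projections of product Lebesgue measure
kill null sets, `Measure.pi_eval_preimage_null`; measurability in `s` from `contactS_exists_measurable_flow` and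
`measurable_measure_prodMk_left`). -/
theorem contactS_exists_oneParticleKernel {σ : ℝ} (Φ : Flow σ N) (ν : Measure (Phase N)) [IsFiniteMeasure ν]
    (hν : ν ≪ liouville (Torus.geometry (Fin 3)) (N + 1) (hsDiameter σ N)) :
    ∃ κ : ProbabilityTheory.Kernel ℝ (T3 × V3), ProbabilityTheory.IsFiniteKernel κ ∧
      (∀ s, κ s ≪ volume) ∧
      ∀ (s : ℝ) (G : T3 × V3 → ℝ), Measurable G → (∃ C : ℝ, ∀ y, |G y| ≤ C) →
        Integrable (fun z => (N + 1 : ℝ)⁻¹ * ∑ i : Fin (N + 1), G (Φ.flow s z i)) ν ∧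
          ∫ z, ((N + 1 : ℝ)⁻¹ * ∑ i : Fin (N + 1), G (Φ.flow s z i)) ∂ν = ∫ y, G y ∂(κ s) := by
  classical
  obtain ⟨Ψ, hΨm, hΨ⟩ := contactS_exists_measurable_flow Φ
  have hgood : ∀ᵐ z ∂ν, z ∈ Φ.good := hν.ae_le Φ.ae_mem_good
  have hΨi : ∀ i : Fin (N + 1), Measurable fun p : ℝ × Phase N => Ψ p i := fun i =>
    (measurable_pi_apply i).comp hΨm
  have hΨsi : ∀ (s : ℝ) (i : Fin (N + 1)), Measurable fun z : Phase N => Ψ (s, z) i := fun s i =>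
    (hΨi i).comp measurable_prodMk_left
  -- the measure-valued map `s ↦ m_s`
  set m : ℝ → Measure (T3 × V3) := fun s =>
    (N + 1 : ℝ≥0∞)⁻¹ • ∑ i : Fin (N + 1), ν.map (fun z => Ψ (s, z) i) with hm
  have hm_apply : ∀ (s : ℝ) {B : Set (T3 × V3)}, MeasurableSet B →
      m s B = (N + 1 : ℝ≥0∞)⁻¹ * ∑ i : Fin (N + 1), ν ((fun z => Ψ (s, z) i) ⁻¹' B) := by
    intro s B hB
    simp only [hm, Measure.smul_apply, smul_eq_mul, Measure.coe_finsetSum, Finset.sum_apply]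
    congr 1
    refine Finset.sum_congr rfl fun i _ => ?_
    exact Measure.map_apply (hΨsi s i) hB
  have hm_meas : Measurable m := by
    refine Measure.measurable_of_measurable_coe m fun B hB => ?_
    simp_rw [hm_apply _ hB]
    refine Measurable.const_mul (Finset.measurable_sum _ fun i _ => ?_) _
    exact measurable_measure_prodMk_left (hB.preimage (hΨi i))
  let κ : ProbabilityTheory.Kernel ℝ (T3 × V3) := ⟨m, hm_meas⟩
  have hκ : ∀ s, κ s = m s := fun s => rfl
  have hN0 : (N + 1 : ℝ≥0∞) ≠ 0 := by exact_mod_cast Nat.succ_ne_zero N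
  have hfin : ProbabilityTheory.IsFiniteKernel κ := by
    refine ⟨⟨(N + 1 : ℝ≥0∞)⁻¹ * ∑ i : Fin (N + 1), ν Set.univ, ?_, fun s => ?_⟩⟩
    · refine ENNReal.mul_lt_top (ENNReal.inv_lt_top.2 (pos_iff_ne_zero.2 hN0)) ?_
      exact ENNReal.sum_lt_top.2 fun i _ => measure_lt_top ν _
    · rw [hκ, hm_apply s MeasurableSet.univ]
      simp only [Set.preimage_univ, le_refl]
  have hac : ∀ s, κ s ≪ volume := by
    intro s
    refine Measure.AbsolutelyContinuous.mk fun B hB hB0 => ?_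
    rw [hκ, hm_apply s hB]
    have hzero : ∀ i : Fin (N + 1), ν ((fun z => Ψ (s, z) i) ⁻¹' B) = 0 := by
      intro i
      apply hν
      have hpre : MeasurableSet ((fun w : Phase N => w i) ⁻¹' B) := measurable_pi_apply i hB
      have hσf : ∀ j : Fin (N + 1), SigmaFinite ((fun _ : Fin (N + 1) => (volume : Measure (T3 × V3))) j) :=
        fun _ => (inferInstance : SigmaFinite (volume : Measure (T3 × V3)))
      have h0 : (volume : Measure (Phase N)) ((fun w : Phase N => w i) ⁻¹' B) = 0 :=
        @Measure.pi_eval_preimage_null (Fin (N + 1)) (fun _ => T3 × V3) _ _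
          (fun _ => (volume : Measure (T3 × V3))) hσf i B hB0
      have h1 : liouville (Torus.geometry (Fin 3)) (N + 1) (hsDiameter σ N)
          ((fun w : Phase N => w i) ⁻¹' B) = 0 :=
        nonpos_iff_eq_zero.1 ((Measure.le_iff'.1 Measure.restrict_le_self _).trans h0.le)
      have h2 : liouville (Torus.geometry (Fin 3)) (N + 1) (hsDiameter σ N)
          ((Φ.flow s) ⁻¹' ((fun w : Phase N => w i) ⁻¹' B)) = 0 := by
        rw [(Φ.measurePreserving s).measure_preimage hpre.nullMeasurableSet]
        exact h1
      have hsub : (fun z => Ψ (s, z) i) ⁻¹' B ⊆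
          (Φ.flow s) ⁻¹' ((fun w : Phase N => w i) ⁻¹' B) ∪ Φ.goodᶜ := by
        intro z hz
        by_cases hzg : z ∈ Φ.good
        · left
          simp only [Set.mem_preimage] at hz ⊢
          rwa [hΨ s z hzg] at hz
        · exact Or.inr hzg
      exact measure_mono_null hsub (measure_union_null h2 Φ.measure_compl_good)
    simp only [hzero, Finset.sum_const_zero, mul_zero]
  refine ⟨κ, hfin, hac, fun s G hG hGb => ?_⟩
  obtain ⟨C, hC⟩ := hGb
  have hGi : ∀ i : Fin (N + 1), Integrable (fun z => G (Φ.flow s z i)) ν := by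
    intro i
    refine Integrable.of_bound ?_ C (ae_of_all _ fun z => ?_)
    · exact (hG.comp ((measurable_pi_apply i).comp (Φ.measurable_flow s))).aestronglyMeasurable
    · rw [Real.norm_eq_abs]
      exact hC _
  have hsum : Integrable (fun z => ∑ i : Fin (N + 1), G (Φ.flow s z i)) ν :=
    integrable_finsetSum _ fun i _ => hGi i
  refine ⟨hsum.const_mul _, ?_⟩
  rw [integral_const_mul, integral_finsetSum _ fun i _ => hGi i]
  have hterm : ∀ i : Fin (N + 1),
      ∫ z, G (Φ.flow s z i) ∂ν = ∫ y, G y ∂(ν.map fun z => Ψ (s, z) i) := by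
    intro i
    rw [integral_map (hΨsi s i).aemeasurable hG.aestronglyMeasurable]
    refine integral_congr_ae ?_
    filter_upwards [hgood] with z hz
    rw [hΨ s z hz]
  simp_rw [hterm]
  have hGi' : ∀ i : Fin (N + 1), Integrable G (ν.map fun z => Ψ (s, z) i) := by
    intro i
    refine Integrable.of_bound hG.aestronglyMeasurable C (ae_of_all _ fun y => ?_)
    rw [Real.norm_eq_abs]
    exact hC _
  rw [hκ]
  simp only [hm]
  rw [integral_smul_measure, integral_finsetSum_measure fun i _ => hGi' i, smul_eq_mul]
  congr 1
  have hcast : (N + 1 : ℝ≥0∞) = ((N + 1 : ℕ) : ℝ≥0∞) := by push_cast; rfl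
  rw [hcast, ENNReal.toReal_inv, ENNReal.toReal_natCast]
  push_cast
  rfl

/-! ## Existence of the slice-wise one-particle density -/

/-- **Existence of the slice-wise one-particle density** (registered sub-lemma `contactS_exists_isOneParticleDensity`)
of every finite law `ν ≪ Liouville` transported by a hard-sphere flow on `𝕋³`, on every horizon: a non-negative `f`,
jointly measurable in `(s, x, v)`, which for EVERY time `s` is the density of the expected empirical one-particle measure
against bounded measurable test functions (`IsOneParticleDensity`; the kernel of `contactS_exists_oneParticleKernel`
differentiated by `contactS_exists_density_of_kernel`). -/
theorem contactS_exists_isOneParticleDensity : ∀ {N : ℕ} {σ : ℝ} (τ : ℝ) (Φ : Flow σ N) (ν : Measure (Phase N)) [IsFiniteMeasure ν], ν ≪ liouville (Torus.geometry (Fin 3)) (N + 1) (hsDiameter σ N) → ∃ f, IsOneParticleDensity τ ν Φ f := by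
  intro N σ τ Φ ν _ hν
  obtain ⟨κ, hκfin, hκac, hκint⟩ := contactS_exists_oneParticleKernel Φ ν hν
  haveI := hκfin
  obtain ⟨f, hf0, hfm, hfκ⟩ := contactS_exists_density_of_kernel κ (volume : Measure (T3 × V3)) hκac
  refine ⟨f, hf0, hfm, fun s _ G hG hGb => ?_⟩
  obtain ⟨hint, hI⟩ := hκint s G hG hGb
  refine ⟨hint, ?_⟩
  rw [hI, hfκ s]
  have hfs : Measurable fun y : T3 × V3 => (f (s, y)).toNNReal :=
    (hfm.comp measurable_prodMk_left).real_toNNReal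
  have hwd : (volume : Measure (T3 × V3)).withDensity (fun y => ENNReal.ofReal (f (s, y))) =
      volume.withDensity (fun y => ((f (s, y)).toNNReal : ℝ≥0∞)) := rfl
  rw [hwd, integral_withDensity_eq_integral_smul hfs]
  refine integral_congr_ae (ae_of_all _ fun y => ?_)
  simp only [NNReal.smul_def, smul_eq_mul, Real.coe_toNNReal _ (hf0 _)]
  ring

/-! ## The conditioned law and the ensemble frame -/

/-- Every conditioned law `μ(· | S) = (μ S)⁻¹ μ|_S` of a law `μ ≪ Liouville` (e.g. the pinned bounded tilts `P_N(· | S)`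
of the local Gibbs law in the ensemble frame) has a slice-wise one-particle density on every horizon — no mass floor, no
pinning and no smallness of `σ` are needed (`μ(· | S)` is always a finite measure, of total mass `(μ S)⁻¹ μ S ≤ 1`, and is
absolutely continuous with respect to `μ`). -/
theorem contactS_exists_isOneParticleDensity_condLaw {σ : ℝ} (τ : ℝ) (Φ : Flow σ N) {μ : Measure (Phase N)}
    (hμ : μ ≪ liouville (Torus.geometry (Fin 3)) (N + 1) (hsDiameter σ N)) (S : Set (Phase N)) :
    ∃ f : Pt1 → ℝ, IsOneParticleDensity τ (condLaw μ S) Φ f := by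
  haveI : IsFiniteMeasure (condLaw μ S) := by
    refine ⟨?_⟩
    simp only [condLaw, Measure.smul_apply, smul_eq_mul, Measure.restrict_apply MeasurableSet.univ, Set.univ_inter]
    exact lt_of_le_of_lt (ENNReal.inv_mul_le_one _) ENNReal.one_lt_top
  have hac : condLaw μ S ≪ μ := by
    refine Measure.AbsolutelyContinuous.mk fun s hs h0 => ?_
    simp only [condLaw, Measure.smul_apply, smul_eq_mul, Measure.restrict_apply hs]
    rw [measure_inter_null_of_null_left S h0, mul_zero]
  exact contactS_exists_isOneParticleDensity τ Φ (condLaw μ S) (hac.trans hμ)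

/-- **Stub S, existence half, in the ensemble frame of the line** (registered sub-lemma `contactS_oneParticleDensity`):
for every pinned cell `S` of the local Gibbs law the conditioned law `P_N(· | S)` HAS a slice-wise one-particle density
`f` (`IsOneParticleDensity`) — the object over which stubs S, K1, M, K4, B′ of the line quantify.  Unconditional (the local
Gibbs law is the Liouville measure with a density, `particleLaw`). -/
theorem contactS_oneParticleDensity : EnsFrame fun _ _ τ _ _ _ _ _ Φ μ S => ∃ f, IsOneParticleDensity τ (condLaw μ S) Φ f := by
  intro a₀ θ₀ u₀ _ _ _ _ _
  refine ⟨1, one_pos, fun σ _ _ _ _ _ _ _ Φ _ _ τ _ _ _ _ _ _ _ => ⟨1, one_pos, 1, one_pos, ?_⟩⟩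
  intro _ _ _ _ _
  refine ⟨0, fun N _ S _ _ _ => ?_⟩
  have hμ : localGibbsLaw σ a₀ u₀ θ₀ N (Φ N) ≪ liouville (Torus.geometry (Fin 3)) (N + 1) (hsDiameter σ N) :=
    withDensity_absolutelyContinuous _ _
  exact contactS_exists_isOneParticleDensity_condLaw τ (Φ N) hμ S

end Summit.AtomisticToContinuum.HydrodynamicLimit.Theorems.LocalSecondLawContact

end
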